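import Summits.Ventures.YMGap.RobustBall.TorusOneLink
import Literature.MathematicalPhysics.QuantumLattice.WilsonLoopsProofs
import Literature.MathematicalPhysics.QuantumLattice.LatticeGaugeDLRLimitPointsProofs
import HarnessLib

/-!
# Robust ball (Y2), area-law side — infinite-volume limit states of the PERTURBED torus states of a member family

HONEST FRAMING: venture file of the cell `pub-ymgap` (QuantumFields programme), track ROBUST-BALL, seat rb-p2 (g2).  This is the
`W`-twin of the tree's infinite-volume bookkeeping for the torus Wilson states
(`Literature.MathematicalPhysics.QuantumLattice.IsInfiniteVolumeLimitAlong` / `infiniteVolumeLimitPoints`, file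
`Literature/MathematicalPhysics/QuantumLattice/LatticeGaugeDLR.lean`; Seiler LNP 159 Ch. 2, Chatterjee arXiv:1803.01950 §2): for a
FAMILY `𝓦 = (W_L)_L` of quasi-local gauge-invariant perturbations of the `SU(N)` torus Wilson action, ONE member per torus size `L + 1`
(e.g. the same finite-range gauge-invariant term written on every torus), the perturbed torus states
`μ_{β, W_L, L+1} ∝ exp(−β S_W − W_L) ∏ dU_e` (`QuasiLocalGaugePerturbation.perturbedMeasure`) transported to `SU(N)^{edges(ℤ^d)}` by the
periodic lift have subsequential limits on bounded continuous cylinder observables; `perturbedLimitPoints β 𝓦` is the set of these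
limit states.  CONTENT: the definition (`IsPerturbedLimitAlong`, `perturbedLimitPoints`), consistency with the tree at `𝓦 = 0`
(`perturbedLimitPoints_zero`), NON-EMPTINESS for every family (Prokhorov / Riesz–Markov on the compact metrizable configuration space,
verbatim the tree's `infiniteVolumeLimitPoints_nonempty_holds`), and the passage of eventual torus Wilson-loop bounds to every limit state
(`abs_rectExpectation_le_of_eventually_perturbed`) — the glue between the cell's torus currency `AreaLawOnBall` (constants uniform in `L`)
and the tree's `ℤ^d` currencies `HasAreaLawWith` / `HasStringTension` / `stringTension` (`StringTensionOnBall.lean`).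
NOT HERE: no DLR statement for the limit states (the perturbed `ℤ^d` specification is rb-p1's `perturbedYM`, a different carrier), no
uniqueness of the limit, no number.  Strong-coupling LATTICE bookkeeping; nothing about the continuum or Clay.
-/

noncomputable section

open MeasureTheory Filter Topology
open Literature.Probability.LatticeModels (Site Torus.proj)
open Literature.MathematicalPhysics.QuantumLattice
open Literature.MathematicalPhysics.QuantumFieldTheory hiding ZdEdge Site

namespace Summit.Ventures.YMGap.RobustBall

variable {d N : ℕ}

/-! ### Families of members and their torus states on `ℤ^d` -/

/-- A FAMILY of perturbations of the `SU(N)` torus Wilson action, one member `𝓦 L : Perturbation d (L+1) N` for each torus size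
`L + 1` (sizes `L + 1` so that `[NeZero _]` is automatic, as in the tree's `IsInfiniteVolumeLimitAlong`). [folklore] -/
abbrev PerturbationFamily (d N : ℕ) : Type := (L : ℕ) → Perturbation d (L + 1) N

/-- The member's torus state `μ_{β,W,L}` transported to configurations on `ℤ^d` by the periodic lift `torusLift L`
(the `W`-twin of the tree's `torusState`). [folklore] -/
def perturbedTorusState (β : ℝ) (L : ℕ) [NeZero L] (W : Perturbation d L N) : Measure (LGConfig d (SUN N)) :=
  (W.perturbedMeasure (fundamentalRep (Fin N)) β).map (torusLift L)

/-- The transported member state is a probability measure. [folklore] -/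
theorem isProbabilityMeasure_perturbedTorusState (β : ℝ) (L : ℕ) [NeZero L] (W : Perturbation d L N) :
    IsProbabilityMeasure (perturbedTorusState β L W) := by
  haveI := isProbabilityMeasure_perturbedMeasure W β
  exact Measure.isProbabilityMeasure_map (measurable_torusLift L).aemeasurable

/-- The member's expectation of the torus restriction of an observable on `ℤ^d` is its integral against the transported
state. [folklore] -/
theorem expectation_toTorusObservable (β : ℝ) (L : ℕ) [NeZero L] (W : Perturbation d L N)
    {F : LGConfig d (SUN N) → ℝ} (hF : Measurable F) :
    W.expectation (fundamentalRep (Fin N)) β (toTorusObservable L F) = ∫ U, F U ∂(perturbedTorusState β L W) := by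
  rw [perturbedTorusState, integral_map (measurable_torusLift L).aemeasurable hF.aestronglyMeasurable]
  rfl

/-! ### Limit states along tori -/

/-- `μ` is the infinite-volume limit of the PERTURBED torus states of the family `𝓦` along the torus sizes `Ls k + 1`:
`μ` is a probability measure on `SU(N)^{edges(ℤ^d)}` and `⟨F ∘ torusLift⟩_{β, 𝓦 (Ls k), Ls k + 1} → ∫ F dμ` for every bounded
continuous cylinder observable `F` — the tree's `IsInfiniteVolumeLimitAlong ρ β Ls μ` with the Wilson expectation replaced by the
member's (Seiler LNP 159 Ch. 2 for the notion). [folklore] -/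
def IsPerturbedLimitAlong (β : ℝ) (𝓦 : PerturbationFamily d N) (Ls : ℕ → ℕ) (μ : Measure (LGConfig d (SUN N))) : Prop :=
  IsProbabilityMeasure μ ∧
    ∀ (F : LGConfig d (SUN N) → ℝ) (S : Finset (ZdEdge d)), IsCylinder F S → Continuous F →
      (∃ C, ∀ U, |F U| ≤ C) →
        Tendsto (fun k : ℕ => (𝓦 (Ls k)).expectation (fundamentalRep (Fin N)) β (toTorusObservable (Ls k + 1) F))
          atTop (𝓝 (∫ U, F U ∂μ))

/-- The set of INFINITE-VOLUME LIMIT STATES of the family `𝓦` at tree coupling `β`: probability measures on `SU(N)^{edges(ℤ^d)}`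
arising as limits of the perturbed torus states along some subsequence of torus sizes `Ls k + 1 → ∞`
(the `W`-twin of the tree's `infiniteVolumeLimitPoints ρ β`). [folklore] -/
def perturbedLimitPoints (β : ℝ) (𝓦 : PerturbationFamily d N) : Set (Measure (LGConfig d (SUN N))) :=
  {μ | ∃ Ls : ℕ → ℕ, StrictMono Ls ∧ IsPerturbedLimitAlong β 𝓦 Ls μ}

/-- A limit state is a probability measure. [folklore] -/
theorem isProbabilityMeasure_of_mem_perturbedLimitPoints {β : ℝ} {𝓦 : PerturbationFamily d N}
    {μ : Measure (LGConfig d (SUN N))} (hμ : μ ∈ perturbedLimitPoints β 𝓦) : IsProbabilityMeasure μ := by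
  obtain ⟨_, _, h, _⟩ := hμ
  exact h

/-- CONSISTENCY with the tree: along any sequence of sizes, the limit notion for the ZERO family is the tree's
`IsInfiniteVolumeLimitAlong` for the Wilson states of the fundamental representation. [folklore] -/
theorem isPerturbedLimitAlong_zero_iff (β : ℝ) (Ls : ℕ → ℕ) (μ : Measure (LGConfig d (SUN N))) :
    IsPerturbedLimitAlong β (0 : PerturbationFamily d N) Ls μ ↔
      IsInfiniteVolumeLimitAlong (fundamentalRep (Fin N)) β Ls μ := by
  simp only [IsPerturbedLimitAlong, IsInfiniteVolumeLimitAlong, Pi.zero_apply,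
    QuasiLocalGaugePerturbation.expectation_zero]

/-- CONSISTENCY with the tree: the limit states of the zero family are exactly the tree's `infiniteVolumeLimitPoints` of the
`SU(N)` Wilson action in the fundamental representation. [folklore] -/
theorem perturbedLimitPoints_zero (β : ℝ) :
    perturbedLimitPoints β (0 : PerturbationFamily d N) = infiniteVolumeLimitPoints (fundamentalRep (Fin N)) β := by
  ext μ
  simp only [perturbedLimitPoints, infiniteVolumeLimitPoints, Set.mem_setOf_eq, isPerturbedLimitAlong_zero_iff]

/-- **LIMIT STATES EXIST for every family** (`(perturbedLimitPoints β 𝓦).Nonempty`): the transported member states are probability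
measures on the compact metrizable space `SU(N)^{edges(ℤ^d)}`, whose space of probability measures is compact and metrizable
(Mathlib `instCompactSpaceProbabilityMeasure`, Lévy–Prokhorov), and weak convergence is convergence of the integrals of bounded
continuous functions — verbatim the tree's `infiniteVolumeLimitPoints_nonempty_holds` with `torusState` replaced by
`perturbedTorusState` (Seiler LNP 159 Ch. 2; Chatterjee arXiv:1803.01950 §2, «by compactness»). [folklore] -/
theorem perturbedLimitPoints_nonempty (β : ℝ) (𝓦 : PerturbationFamily d N) : (perturbedLimitPoints β 𝓦).Nonempty := by
  haveI := fun L : ℕ => isProbabilityMeasure_perturbedTorusState (d := d) β (L + 1) (𝓦 L)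
  let P : ℕ → ProbabilityMeasure (LGConfig d (SUN N)) := fun L => ⟨perturbedTorusState β (L + 1) (𝓦 L), inferInstance⟩
  obtain ⟨μ, -, φ, hφ, hlim⟩ :=
    (isCompact_univ (X := ProbabilityMeasure (LGConfig d (SUN N)))).tendsto_subseq fun n => Set.mem_univ (P n)
  refine ⟨(μ : Measure (LGConfig d (SUN N))), φ, hφ, inferInstance, fun F S _ hFc hFb => ?_⟩
  obtain ⟨C, hC⟩ := hFb
  let Fb : BoundedContinuousFunction (LGConfig d (SUN N)) ℝ :=
    BoundedContinuousFunction.ofNormedAddCommGroup F hFc C (fun U => by simpa [Real.norm_eq_abs] using hC U)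
  have hE : (fun k : ℕ => (𝓦 (φ k)).expectation (fundamentalRep (Fin N)) β (toTorusObservable (φ k + 1) F)) =
      fun k => ∫ U, Fb U ∂(P (φ k) : Measure (LGConfig d (SUN N))) :=
    funext fun k => expectation_toTorusObservable β (φ k + 1) (𝓦 (φ k)) hFc.measurable
  have key : Tendsto (fun k : ℕ => ∫ U, Fb U ∂(P (φ k) : Measure (LGConfig d (SUN N)))) atTop
      (𝓝 (∫ U, Fb U ∂(μ : Measure (LGConfig d (SUN N))))) :=
    (ProbabilityMeasure.tendsto_iff_forall_integral_tendsto.1 hlim) Fb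
  rw [hE]
  exact key

/-! ### Passage of torus Wilson-loop bounds to the limit states -/

/-- The character of the currencies below: `χ_N = (1/N) Re tr` on `SU(N)` (the tree's `normalisedCharacter N ∘ fundamentalRep`,
as in `suFundStringTension`). [folklore] -/
theorem continuous_fundChar (N : ℕ) : Continuous fun g : SUN N => normalisedCharacter N (fundamentalRep (Fin N) g) :=
  continuous_normalisedCharacter_comp (continuous_fundamentalRep (Fin N))

/-- The rectangular loop expectation `W_μ(R,T)` of a limit state (origin, `(0,1)` plane) is the limit of the member's torus
Wilson-loop expectations `⟨W_{R×T}⟩_{β, 𝓦 (Ls k), Ls k + 1}` along the defining subsequence. [folklore] -/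
theorem tendsto_expectation_wilsonLoop [NeZero d] {β : ℝ} {𝓦 : PerturbationFamily d N} {μ : Measure (LGConfig d (SUN N))}
    {Ls : ℕ → ℕ} (hμ : IsPerturbedLimitAlong β 𝓦 Ls μ) (R T : ℕ) :
    Tendsto (fun k : ℕ => (𝓦 (Ls k)).expectation (fundamentalRep (Fin N)) β
        (wilsonLoop (fundamentalRep (Fin N)) (0 : Literature.MathematicalPhysics.QuantumFieldTheory.Site d (Ls k + 1)) 0 1 R T))
      atTop (𝓝 (rectExpectation μ (fun g => normalisedCharacter N (fundamentalRep (Fin N) g)) 0 1 R T)) := by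
  have hχ := continuous_fundChar N
  have h := hμ.2 (wilsonLoopObs (fun g => normalisedCharacter N (fundamentalRep (Fin N) g)) (rectWalk (0 : Site d) 0 1 R T))
    _ (isCylinder_wilsonLoopObs _ _) (continuous_wilsonLoopObs hχ _) (exists_abs_wilsonLoopObs_le hχ _)
  have h0 : ∀ L : ℕ, Torus.proj L (0 : Site d) = 0 := fun L => by funext i; simp [Torus.proj]
  simp only [toTorusObservable_wilsonLoopObs_rectWalk, h0] at h
  exact h

/-- **Eventual torus upper bounds pass to limit states.** If `|⟨W_{R×T}⟩_{β, 𝓦 L, L+1}| ≤ b` for all large `L`, then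
`|W_μ(R,T)| ≤ b` for every `μ ∈ perturbedLimitPoints β 𝓦`. [folklore] -/
theorem abs_rectExpectation_le_of_eventually_perturbed [NeZero d] {β : ℝ} {𝓦 : PerturbationFamily d N}
    {μ : Measure (LGConfig d (SUN N))} (hμ : μ ∈ perturbedLimitPoints β 𝓦) {R T : ℕ} {b : ℝ}
    (h : ∀ᶠ L : ℕ in atTop, |(𝓦 L).expectation (fundamentalRep (Fin N)) β
        (wilsonLoop (fundamentalRep (Fin N)) (0 : Literature.MathematicalPhysics.QuantumFieldTheory.Site d (L + 1)) 0 1 R T)| ≤ b) :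
    |rectExpectation μ (fun g => normalisedCharacter N (fundamentalRep (Fin N) g)) 0 1 R T| ≤ b := by
  obtain ⟨Ls, hLs, hlim⟩ := hμ
  exact le_of_tendsto (tendsto_expectation_wilsonLoop hlim R T).abs (hLs.tendsto_atTop.eventually h)

/-- **Eventual torus lower bounds pass to limit states.** If `a ≤ ⟨W_{R×T}⟩_{β, 𝓦 L, L+1}` for all large `L`, then
`a ≤ W_μ(R,T)` for every `μ ∈ perturbedLimitPoints β 𝓦`. [folklore] -/
theorem le_rectExpectation_of_eventually_perturbed [NeZero d] {β : ℝ} {𝓦 : PerturbationFamily d N}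
    {μ : Measure (LGConfig d (SUN N))} (hμ : μ ∈ perturbedLimitPoints β 𝓦) {R T : ℕ} {a : ℝ}
    (h : ∀ᶠ L : ℕ in atTop, a ≤ (𝓦 L).expectation (fundamentalRep (Fin N)) β
        (wilsonLoop (fundamentalRep (Fin N)) (0 : Literature.MathematicalPhysics.QuantumFieldTheory.Site d (L + 1)) 0 1 R T)) :
    a ≤ rectExpectation μ (fun g => normalisedCharacter N (fundamentalRep (Fin N) g)) 0 1 R T := by
  obtain ⟨Ls, hLs, hlim⟩ := hμ
  exact ge_of_tendsto (tendsto_expectation_wilsonLoop hlim R T) (hLs.tendsto_atTop.eventually h)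

end Summit.Ventures.YMGap.RobustBall

end
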